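import Summits.QuantumFields.YangMills.Theorems.BalabanUVNodesK0Stub1FlatChartValued
import Summits.QuantumFields.YangMills.Theorems.BalabanUVNodesK0Stub1DoubleBarFramesSU
import Summits.QuantumFields.YangMills.Theorems.BalabanUVNodesN07ChartLogReality
import HarnessLib

/-!
# K0⁷ STUB 1 (`stub_prop8StepCoP13`), S4b ♭ road — **THE ♭ CHART IS `𝔰𝔲(N)`-VALUED ON `𝔰𝔲(N)`-VALUED FIELDS**: `U̿^{(j)}(e^{iηA})(c) ∈ SU(N)` on the read territory for Hermitian traceless `A`
# under the (0.4) winding guard `δ_N`, hence `Q♭(A)(j,c) = −i·log U̿ ∈ herm0`; on the weighted ball of the (152) weights; and — by the value-module engine (CLAIM-6a) — the implicit ♭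
# chart `Dsel♭(A′)` and the dressed field `A′ − H·Dsel♭(A′)` are Hermitian traceless at Hermitian traceless `A′` (print's «`A` with values in 𝔤», (152) p.301)

Cell `pub-ymgap`, width seat `pub-ymgap-k0-s1-w4` g2 (CLAIM-6b, bus 2026-08-28T12:28Z; AMENDED 12:5xZ: the predicate-propagation ∕ determinant rows announced for this path are
NOT re-typed — k0-s1-w1 g7's p633685 `K0Stub1DoubleBarFramesSU.{pred_dbarIterU_of_reads_of_le, suN_pred_one∕_mul∕_inv∕_eml}` (landed 12:33Z) are consumed BY NAME instead).
`--kind proof --supports stmt-QuantumFields-20541 --as helper`; count-neutral.  [15] = [Balaban1985Variational]; [B7] = [Balaban1985Averaging]; [I] = [Balaban1987RG1].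

WHY.  k0-s1-w1 g7's fibre-curve junction reads `U t := e^{iη·chart♭(A′₁ + tδ)}` in `SU(N)` (`exp_mem_specialUnitaryGroup_of_mem_lieSU`), i.e. needs the dressed ♭ field HERMITIAN
TRACELESS; k0-s1-w2's reality certificate needs the same of `Dsel♭`.  Route: «`∈ SU(N)`» is a multiplicative `eml`-stable predicate below the guard `δ_N = min(1∕3, π∕N)` (p633685), so
it passes from the bond variables `e^{iηA(b)}` (`A(b) ∈ herm0`) through the double-bar tower on the read territory of an index; `log` of an `SU(N)` element within `δ_N` of `1` is in
`𝔰𝔲(N)` (`B7Prop2Explicit.star_mlog_eq_neg`, `ExpMeanLog.trace_mlog_eq_zero` — the guard is genuinely `N`-dependent: `e^{2πi∕N}·1`), and `Q♭ = −i·log U̿` is Hermitian traceless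
(n07-w2's `neg_I_smul_mem_herm0`).  Then CLAIM-6a's engine at `S := herm0` («the simple iteration method», p.286) transports this to ANY `Dfun` with (55)♭ + (49)♭.

WHAT IS PROVED (sorry-free; no definition; axioms standard; generic `P`, fibre `M_N(ℂ)`, `N ≥ 1`).
* §1 `suN_coe_expCfg` (`e^{iηA(b)} ∈ SU(N)` for `A(b) ∈ herm0`), ★ `suN_dbarIterU_expCfg_of_reads` (the tower on the read territory of `(j,c)`: budget `30400ℓ²Lʲs₀ ≤ 1`, guard
  `8ℓLʲs₀ ≤ θ < δ_N`), ★★ `chartLogFlat_mem_herm0_of_reads` (`Q♭(A)(j,c) ∈ herm0`).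
* §2 (K0 carrier: (152) weights `IsLevWeight`, collar, `60800ℓ²LR ≤ 1`, guard `16ℓLR ≤ θ < δ_N`) ★★ `chartLogFlat_mem_herm0_weightedBall_P`; `realKernel_mem` (a complex-cast real
  kernel preserves every value module).
* §3 ★★★ `chartDFlat_valued_herm0` — CLAIM-6a's `chartDFlat_valued_of_chartLogFlat` at `S := herm0 (Fin N)`: nested `D` (`D.k = k`), `Adm22 D R′ M` (`2L ≤ R′`, `1 ≤ M`), the (152)
  weights, a ℂ-linear `H` with a REAL kernel and the sup (46) row `B₀ ≥ 0`, FILE α's window (`0 < ε`, `9C₂♭B₀ε < 1`, `3ε ≤ R⋆♭∕4`), the guard `32ℓLε ≤ θ < δ_N`, ANY `Dfun` with the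
  ball bound `4C₂♭ε²` and (49)♭ on the `ε`-ball (e.g. FILE α's `Dsel♭`): Hermitian traceless `A′` in the ball ⇒ `Dfun A′ c ∈ herm0` and `(A′ − H·Dfun A′) b ∈ herm0`.
HONEST SCOPE.  Bookkeeping over kernel-checked engines (p633685's tower predicate, lit `ExpMeanLog`, n07-w2's `herm0`∕`lieSU` letters and weighted-ball read bound, CLAIM-6a); the
guard is displayed, not discharged (one more `N`-dependent smallness on `ε`, exactly as the tree's (0.4) guard is); nothing of [15]∕[B7] asserted; `stub_prop8StepCoP13` ∕ K0⁷ NOT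
closed; N07 NOT discharged; no summit statement is proved by this seat; counts unmoved (28∕28 · 5∕27); one finite 𝕋⁴ programme at fixed ε — R4 closes the conditional finite-𝕋⁴
rung only; the YM mass gap (Clay) is NOT proved by any of this.  No `sorry`, no `def`, no `instance`, no `notation`.

References: [15] (20) p.281, (44)–(49) pp.285–286, (55) p.286, (152) p.301, (156)–(157) p.302; [B7] (19)–(23) p.21, (89) p.31, (110) p.34, Prop. 4 (134)–(135) p.38;
[I] (0.4)–(0.9) p.253.
-/

set_option autoImplicit false

noncomputable section

open scoped BigOperators Matrix.Norms.L2Operator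
open NormedSpace

namespace Summit.QuantumFields.YangMills.Theorems.K0Stub1FlatChartSlN

open Literature.MathematicalPhysics.QuantumFieldTheory.Balaban1983to89
open T4Continuum BlockAveraging ExpMeanLog MatrixLog
open B5Eq118OneStroke (iterBlockOf)
open B6SectADomainsV1 (Domains)
open B6SectAOperatorsV1 (BondIdx)
open B9AdOrthogonal (herm0 mem_herm0)
open T4AdjointCovarianceUnitary (lieSU mem_lieSU_iff exp_mem_specialUnitaryGroup_of_mem_lieSU)
open Summit.QuantumFields.YangMills.Theorems.FlatCubeOpsText (Adm22)
open Summit.QuantumFields.YangMills.Theorems.K0FlatCubeOpsTextP (IsLevWeight)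
open Summit.QuantumFields.YangMills.Theorems.Prop8Chart (expCfg coe_expCfg collar_of_adm22)
open Summit.QuantumFields.YangMills.Theorems.Prop8ChartDoubleBar (dbarIterU chartLogFlat chartLogFlat_apply norm_dbarIterU_sub_one_le_two_mul₀)
open Summit.QuantumFields.YangMills.Theorems.K0Stub1DoubleBarFramesSU (pred_dbarIterU_of_reads_of_le suN_pred_one suN_pred_mul suN_pred_inv suN_pred_eml)
open Summit.QuantumFields.YangMills.BalabanUVNodes.N07ChartLogReality (I_eta_smul_mem_lieSU neg_I_smul_mem_herm0)
open Summit.QuantumFields.YangMills.BalabanUVNodes.N07ChartRemainderP (norm_expCfg_sub_one_le_of_weightedBall)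
open Summit.QuantumFields.YangMills.Theorems.K0Stub1FlatChartValued (chartDFlat_valued_of_chartLogFlat)

variable {P : Params} {N : ℕ} [NeZero N]

/-! ## §1 `U̿^{(j)}(e^{iηA})(c) ∈ SU(N)` on the read territory and `Q♭(A)(j,c) ∈ herm0` -/

omit [NeZero N] in
/-- `e^{iηA(b)} ∈ SU(N)` for `A(b)` Hermitian traceless (`iηA(b) ∈ 𝔰𝔲(N)`). [cite: Balaban1985Variational, (152) p.301; Balaban1985Averaging, (23) p.21] -/
theorem suN_coe_expCfg (η : ℝ) {A : PBond P 0 → Matrix (Fin N) (Fin N) ℂ} (b : PBond P 0) (hA : A b ∈ herm0 (Fin N)) :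
    ∃ s : Matrix.specialUnitaryGroup (Fin N) ℂ, (s : Matrix (Fin N) (Fin N) ℂ) = ((expCfg η A b : (Matrix (Fin N) (Fin N) ℂ)ˣ) : Matrix (Fin N) (Fin N) ℂ) :=
  ⟨⟨_, exp_mem_specialUnitaryGroup_of_mem_lieSU (I_eta_smul_mem_lieSU η hA)⟩, by rw [coe_expCfg]⟩

/-- ★ **`U̿^{(j)}(e^{iηA})(c) ∈ SU(N)` ON THE READ TERRITORY OF THE INDEX `(j, c)`**: if the charted bond variables read by the index are within `s₀` of `1` and Hermitian-traceless
charted (`A(b) ∈ herm0`), with the budget `30400ℓ²Lʲs₀ ≤ 1` and the winding guard `8ℓLʲs₀ ≤ θ < δ_N` — p633685's tower predicate at «`∈ SU(N)`».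
[cite: Balaban1987RG1, (0.4)-(0.9) p.253; Balaban1985Averaging, Prop. 4 (134)-(135) p.38] -/
theorem suN_dbarIterU_expCfg_of_reads (η : ℝ) (D : Domains P) (idx : BondIdx D) (A : PBond P 0 → Matrix (Fin N) (Fin N) ℂ) {s₀ θ : ℝ} (hs₀ : 0 ≤ s₀)
    (hθ : θ < deltaSU (Fin N))
    (hbudget : 8 * 3800 * (((P.d + 2) * P.L : ℕ) : ℝ) ^ 2 * (P.L : ℝ) ^ (idx.1.1 : ℕ) * s₀ ≤ 1)
    (hguard : 8 * (((P.d + 2) * P.L : ℕ) : ℝ) * (P.L : ℝ) ^ (idx.1.1 : ℕ) * s₀ ≤ θ)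
    (hA : ∀ b : PBond P 0, (iterBlockOf (idx.1.1 : ℕ) b.src = idx.1.2.src ∨ iterBlockOf (idx.1.1 : ℕ) b.src = idx.1.2.tgt) →
      (iterBlockOf (idx.1.1 : ℕ) b.tgt = idx.1.2.src ∨ iterBlockOf (idx.1.1 : ℕ) b.tgt = idx.1.2.tgt) →
      ‖((expCfg η A b : (Matrix (Fin N) (Fin N) ℂ)ˣ) : Matrix (Fin N) (Fin N) ℂ) - 1‖ ≤ s₀)
    (hAh : ∀ b : PBond P 0, (iterBlockOf (idx.1.1 : ℕ) b.src = idx.1.2.src ∨ iterBlockOf (idx.1.1 : ℕ) b.src = idx.1.2.tgt) →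
      (iterBlockOf (idx.1.1 : ℕ) b.tgt = idx.1.2.src ∨ iterBlockOf (idx.1.1 : ℕ) b.tgt = idx.1.2.tgt) → A b ∈ herm0 (Fin N)) :
    ∃ s : Matrix.specialUnitaryGroup (Fin N) ℂ, (s : Matrix (Fin N) (Fin N) ℂ) =
      ((dbarIterU (idx.1.1 : ℕ) (expCfg η A) idx.1.2 : (Matrix (Fin N) (Fin N) ℂ)ˣ) : Matrix (Fin N) (Fin N) ℂ) := by
  have hj : (idx.1.1 : ℕ) ≤ P.m + P.K := (Nat.lt_succ_iff.mp idx.1.1.isLt).trans D.hk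
  have hθ1 : θ ≤ 1 := (hθ.le.trans (min_le_left _ _)).trans (by norm_num)
  set S : Set (Site P (idx.1.1 : ℕ)) := {y | y = idx.1.2.src ∨ y = idx.1.2.tgt} with hS
  exact pred_dbarIterU_of_reads_of_le (fun M : Matrix (Fin N) (Fin N) ℂ => ∃ s : Matrix.specialUnitaryGroup (Fin N) ℂ, (s : Matrix (Fin N) (Fin N) ℂ) = M)
    suN_pred_one suN_pred_mul suN_pred_inv hθ1 (fun W hW hs => suN_pred_eml hθ W hW hs) (idx.1.1 : ℕ) hj S (expCfg η A) s₀ hs₀ hbudget hguard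
    (fun b hs ht => hA b hs ht) (fun b hs ht => suN_coe_expCfg η b (hAh b hs ht)) idx.1.2 (Or.inl rfl) (Or.inr rfl)

/-- ★★ **`Q♭(A)(j,c) ∈ herm0` (index form, guarded)**: under the hypotheses of `suN_dbarIterU_expCfg_of_reads`, `chartLogFlat η D A (j,c) = −i·log U̿^{(j)}(e^{iηA})(c)` is Hermitian
traceless — `U̿ ∈ SU(N)`, `‖U̿ − 1‖ ≤ 2Lʲs₀ ≤ θ∕(4ℓ) ≤ 1∕4`, `N‖U̿ − 1‖ < π`, so `log U̿ ∈ 𝔰𝔲(N)` (`star_mlog_eq_neg`, `trace_mlog_eq_zero`).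
[cite: Balaban1985Variational, (20) p.281, (152) p.301, (156) p.302; Balaban1985Averaging, (20)-(26) pp.21-22] -/
theorem chartLogFlat_mem_herm0_of_reads (η : ℝ) (D : Domains P) (idx : BondIdx D) (A : PBond P 0 → Matrix (Fin N) (Fin N) ℂ) {s₀ θ : ℝ} (hs₀ : 0 ≤ s₀)
    (hθ : θ < deltaSU (Fin N))
    (hbudget : 8 * 3800 * (((P.d + 2) * P.L : ℕ) : ℝ) ^ 2 * (P.L : ℝ) ^ (idx.1.1 : ℕ) * s₀ ≤ 1)
    (hguard : 8 * (((P.d + 2) * P.L : ℕ) : ℝ) * (P.L : ℝ) ^ (idx.1.1 : ℕ) * s₀ ≤ θ)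
    (hA : ∀ b : PBond P 0, (iterBlockOf (idx.1.1 : ℕ) b.src = idx.1.2.src ∨ iterBlockOf (idx.1.1 : ℕ) b.src = idx.1.2.tgt) →
      (iterBlockOf (idx.1.1 : ℕ) b.tgt = idx.1.2.src ∨ iterBlockOf (idx.1.1 : ℕ) b.tgt = idx.1.2.tgt) →
      ‖((expCfg η A b : (Matrix (Fin N) (Fin N) ℂ)ˣ) : Matrix (Fin N) (Fin N) ℂ) - 1‖ ≤ s₀)
    (hAh : ∀ b : PBond P 0, (iterBlockOf (idx.1.1 : ℕ) b.src = idx.1.2.src ∨ iterBlockOf (idx.1.1 : ℕ) b.src = idx.1.2.tgt) →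
      (iterBlockOf (idx.1.1 : ℕ) b.tgt = idx.1.2.src ∨ iterBlockOf (idx.1.1 : ℕ) b.tgt = idx.1.2.tgt) → A b ∈ herm0 (Fin N)) :
    chartLogFlat η D A idx ∈ herm0 (Fin N) := by
  have hj : (idx.1.1 : ℕ) ≤ P.m + P.K := (Nat.lt_succ_iff.mp idx.1.1.isLt).trans D.hk
  have hℓ1 : (1 : ℝ) ≤ (((P.d + 2) * P.L : ℕ) : ℝ) := by
    exact_mod_cast Nat.one_le_iff_ne_zero.mpr (Nat.mul_ne_zero (by omega) (by have := P.hL.2; omega))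
  obtain ⟨s, hs⟩ := suN_dbarIterU_expCfg_of_reads η D idx A hs₀ hθ hbudget hguard hA hAh
  set S : Set (Site P (idx.1.1 : ℕ)) := {y | y = idx.1.2.src ∨ y = idx.1.2.tgt} with hS
  have hnear := norm_dbarIterU_sub_one_le_two_mul₀ hj S (expCfg η A) hs₀ hbudget (fun b hs' ht' => hA b hs' ht') idx.1.2 (Or.inl rfl) (Or.inr rfl)
  -- sizes: `‖U̿ − 1‖ ≤ 2Lʲs₀ ≤ 8ℓLʲs₀ ≤ θ < δ_N ≤ 1∕3`, and `≤ 1∕4`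
  have h2θ : 2 * ((P.L : ℝ) ^ (idx.1.1 : ℕ) * s₀) ≤ θ := by
    have h0 : 0 ≤ (P.L : ℝ) ^ (idx.1.1 : ℕ) * s₀ := by positivity
    nlinarith
  have hM : ‖(s : Matrix (Fin N) (Fin N) ℂ) - 1‖ ≤ θ := by rw [hs]; exact hnear.trans h2θ
  have hM3 : ‖(s : Matrix (Fin N) (Fin N) ℂ) - 1‖ ≤ 1 / 3 := hM.trans (hθ.le.trans (min_le_left _ _))
  have hM4 : ‖(s : Matrix (Fin N) (Fin N) ℂ) - 1‖ ≤ 1 / 4 := by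
    rw [hs]; refine hnear.trans ?_
    have h0 : 0 ≤ (P.L : ℝ) ^ (idx.1.1 : ℕ) * s₀ := by positivity
    have h1 : 8 * 3800 * (((P.d + 2) * P.L : ℕ) : ℝ) ^ 2 * ((P.L : ℝ) ^ (idx.1.1 : ℕ) * s₀) ≤ 1 := by
      rw [show 8 * 3800 * (((P.d + 2) * P.L : ℕ) : ℝ) ^ 2 * ((P.L : ℝ) ^ (idx.1.1 : ℕ) * s₀) = 8 * 3800 * (((P.d + 2) * P.L : ℕ) : ℝ) ^ 2 * (P.L : ℝ) ^ (idx.1.1 : ℕ) * s₀ by ring]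
      exact hbudget
    nlinarith [(one_le_pow₀ (M₀ := ℝ) hℓ1 : (1:ℝ) ≤ _ ^ 2)]
  have hcard : (0 : ℝ) < Fintype.card (Fin N) := by
    rw [Fintype.card_fin]; exact_mod_cast Nat.pos_of_ne_zero (NeZero.ne N)
  have hMπ : Fintype.card (Fin N) * ‖(s : Matrix (Fin N) (Fin N) ℂ) - 1‖ < Real.pi := by
    have h1 : ‖(s : Matrix (Fin N) (Fin N) ℂ) - 1‖ < Real.pi / Fintype.card (Fin N) := lt_of_le_of_lt hM (hθ.trans_le (min_le_right _ _))
    calc (Fintype.card (Fin N) : ℝ) * ‖(s : Matrix (Fin N) (Fin N) ℂ) - 1‖ < Fintype.card (Fin N) * (Real.pi / Fintype.card (Fin N)) := mul_lt_mul_of_pos_left h1 hcard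
      _ = Real.pi := mul_div_cancel₀ _ hcard.ne'
  -- `log U̿ ∈ 𝔰𝔲(N)`
  have hlog : mlog (s : Matrix (Fin N) (Fin N) ℂ) ∈ lieSU (Fin N) := by
    letI : CStarAlgebra (Matrix (Fin N) (Fin N) ℂ) := {}
    rw [mem_lieSU_iff]
    exact ⟨B7Prop2Explicit.star_mlog_eq_neg s.2.1 hM4, trace_mlog_eq_zero s.2 hM3 hMπ⟩
  rw [chartLogFlat_apply, ← hs]
  exact neg_I_smul_mem_herm0 hlog

/-! ## §2 The K0 carrier: the weighted ball of the (152) weights -/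

/-- ★★ **`Q♭(A) ∈ herm0` ON THE WEIGHTED BALL OF THE (152) WEIGHTS** for bondwise Hermitian traceless `A`: nested `D` (`D.k = k`) with the collar property, the K0 level weights, a
radius with `60800·ℓ²·L·R ≤ 1` and the guard `16ℓLR ≤ θ < δ_N`, and `w₁(b)‖A b‖ < R` (§1 at `s₀ = 2LR∕Lʲ`, n07-w2's `norm_expCfg_sub_one_le_of_weightedBall`).
[cite: Balaban1985Variational, (20) p.281, (44)-(47) p.285, (152) p.301, (156) p.302] -/
theorem chartLogFlat_mem_herm0_weightedBall_P (k : ℕ) (D : Domains P) (hDk : D.k = k)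
    (hcollar : ∀ (i : ℕ) (e : PBond P (i + 1)), D.LamBond (i + 1) e → ∀ z : Site P i, (blockOf z = e.src ∨ blockOf z = e.tgt) → z ∈ D.Om i)
    {w : ℕ → PBond P 0 → ℝ} (hw : IsLevWeight P k D w)
    {R θ : ℝ} (hR : 16 * 3800 * (((P.d + 2) * P.L : ℕ) : ℝ) ^ 2 * (P.L : ℝ) * R ≤ 1) (hθ : θ < deltaSU (Fin N))
    (hguard : 16 * (((P.d + 2) * P.L : ℕ) : ℝ) * (P.L : ℝ) * R ≤ θ)
    {A : PBond P 0 → Matrix (Fin N) (Fin N) ℂ} (hA : ∀ b, w 1 b * ‖A b‖ < R) (hAh : ∀ b, A b ∈ herm0 (Fin N)) (idx : BondIdx D) :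
    chartLogFlat (((P.L : ℝ)⁻¹) ^ k) D A idx ∈ herm0 (Fin N) := by
  have hL0 : (0 : ℝ) < P.L := lt_of_lt_of_le one_pos (by exact_mod_cast P.L_pos)
  have hℓ0 : (0 : ℝ) < (((P.d + 2) * P.L : ℕ) : ℝ) := by exact_mod_cast Nat.pos_of_ne_zero (Nat.mul_ne_zero (by omega) (by have := P.hL.2; omega))
  have hLj : 0 < (P.L : ℝ) ^ (idx.1.1 : ℕ) := by positivity
  have hR0 : 0 ≤ R := by
    have := hA (⟨fun _ => 0, idx.1.2.dir⟩ : PBond P 0)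
    have hw0 : 0 ≤ w 1 ⟨fun _ => 0, idx.1.2.dir⟩ * ‖A ⟨fun _ => 0, idx.1.2.dir⟩‖ := by
      rw [hw 1, pow_one]; exact mul_nonneg (by positivity) (norm_nonneg _)
    linarith
  have hR' : 12800 * (((P.d + 2) * P.L : ℕ) : ℝ) ^ 2 * (P.L : ℝ) * R ≤ 1 := by nlinarith [show 0 ≤ (((P.d + 2) * P.L : ℕ) : ℝ) ^ 2 * (P.L : ℝ) * R by positivity]
  set s₀ : ℝ := 2 * (P.L : ℝ) * R * ((P.L : ℝ) ^ (idx.1.1 : ℕ))⁻¹ with hs₀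
  have hs₀0 : 0 ≤ s₀ := by positivity
  have hLs : (P.L : ℝ) ^ (idx.1.1 : ℕ) * s₀ = 2 * (P.L : ℝ) * R := by rw [hs₀]; field_simp
  have hbudget : 8 * 3800 * (((P.d + 2) * P.L : ℕ) : ℝ) ^ 2 * (P.L : ℝ) ^ (idx.1.1 : ℕ) * s₀ ≤ 1 := by
    rw [show 8 * 3800 * (((P.d + 2) * P.L : ℕ) : ℝ) ^ 2 * (P.L : ℝ) ^ (idx.1.1 : ℕ) * s₀ = 8 * 3800 * (((P.d + 2) * P.L : ℕ) : ℝ) ^ 2 * ((P.L : ℝ) ^ (idx.1.1 : ℕ) * s₀) by ring,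
      hLs]; linarith
  have hguard' : 8 * (((P.d + 2) * P.L : ℕ) : ℝ) * (P.L : ℝ) ^ (idx.1.1 : ℕ) * s₀ ≤ θ := by
    rw [show 8 * (((P.d + 2) * P.L : ℕ) : ℝ) * (P.L : ℝ) ^ (idx.1.1 : ℕ) * s₀ = 8 * (((P.d + 2) * P.L : ℕ) : ℝ) * ((P.L : ℝ) ^ (idx.1.1 : ℕ) * s₀) by ring, hLs]
    linarith
  have hA' : ∀ b : PBond P 0, (iterBlockOf (idx.1.1 : ℕ) b.src = idx.1.2.src ∨ iterBlockOf (idx.1.1 : ℕ) b.src = idx.1.2.tgt) →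
      (iterBlockOf (idx.1.1 : ℕ) b.tgt = idx.1.2.src ∨ iterBlockOf (idx.1.1 : ℕ) b.tgt = idx.1.2.tgt) →
      ‖((expCfg (((P.L : ℝ)⁻¹) ^ k) A b : (Matrix (Fin N) (Fin N) ℂ)ˣ) : Matrix (Fin N) (Fin N) ℂ) - 1‖ ≤ s₀ :=
    fun b hb _ => norm_expCfg_sub_one_le_of_weightedBall k D hDk hcollar hw hR' hA idx b hb
  exact chartLogFlat_mem_herm0_of_reads (((P.L : ℝ)⁻¹) ^ k) D idx A hs₀0 hθ hbudget hguard' hA' fun b _ _ => hAh b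

omit [NeZero N] in
/-- a complex-cast REAL kernel preserves every value module (`H♭`'s ♭ kernel, `M♭`'s kernel). [cite: Balaban1985Variational, (45) p.285] -/
theorem realKernel_mem {ι κ : Type*} [Fintype κ] (S : Submodule ℝ (Matrix (Fin N) (Fin N) ℂ)) (Hs : (κ → Matrix (Fin N) (Fin N) ℂ) → (ι → Matrix (Fin N) (Fin N) ℂ))
    (h : ι → κ → ℝ) (hHs : ∀ X b, Hs X b = ∑ c, ((h b c : ℝ) : ℂ) • X c) {X : κ → Matrix (Fin N) (Fin N) ℂ} (hX : ∀ c, X c ∈ S) (b : ι) :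
    Hs X b ∈ S := by
  rw [hHs]
  exact S.sum_mem fun c _ => by rw [Complex.coe_smul]; exact S.smul_mem _ (hX c)

/-! ## §3 The implicit ♭ chart at Hermitian traceless fields -/

/-- ★★★ **THE IMPLICIT ♭ CHART IS `𝔰𝔲(N)`-VALUED ON `𝔰𝔲(N)`-VALUED FIELDS** (CLAIM-6a's engine at `S := herm0`): nested `D` (`D.k = k`), `Adm22 D R′ M` (`2L ≤ R′`, `1 ≤ M`), the (152)
weights, a ℂ-linear `H` with a REAL kernel and the sup (46) row `B₀ ≥ 0`, FILE α's window (`0 < ε`, `9C₂♭B₀ε < 1`, `3ε ≤ R⋆♭∕4`), the winding guard `32ℓLε ≤ θ < δ_N`, and ANY `Dfun`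
with the ball bound `‖Dfun A′ i‖ ≤ 4C₂♭ε²` and (49)♭ on the `ε`-ball: for every bondwise Hermitian traceless `A′` in the ball, `Dfun A′` and `A′ − H·Dfun A′` are bondwise Hermitian
traceless (print's «`A` with values in 𝔤» for the dressed ♭ field). [cite: Balaban1985Variational, (47)-(49) pp.285-286, (55) p.286, (152) p.301; Balaban1987RG1, (0.4)-(0.9) p.253] -/
theorem chartDFlat_valued_herm0 (k : ℕ) (D : Domains P) (hDk : D.k = k) {R' M : ℕ} (hAdm : Adm22 D R' M) (hR'L : 2 * P.L ≤ R') (hM : 1 ≤ M)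
    {w : ℕ → PBond P 0 → ℝ} (hw : IsLevWeight P k D w)
    (H : (BondIdx D → Matrix (Fin N) (Fin N) ℂ) →ₗ[ℂ] (PBond P 0 → Matrix (Fin N) (Fin N) ℂ)) (hker : PBond P 0 → BondIdx D → ℝ)
    (hH : ∀ (X : BondIdx D → Matrix (Fin N) (Fin N) ℂ) (b : PBond P 0), H X b = ∑ t, ((hker b t : ℝ) : ℂ) • X t)
    {B₀ : ℝ} (hB₀ : 0 ≤ B₀)
    (hHB : ∀ (X : BondIdx D → Matrix (Fin N) (Fin N) ℂ) (t : ℝ), 0 ≤ t → (∀ i, ‖X i‖ ≤ t) → ∀ b, w 1 b * ‖H X b‖ ≤ B₀ * t)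
    {ε θ : ℝ} (hε : 0 < ε)
    (hq : 9 * (64 * (P.L : ℝ) / (60800 * (((P.d + 2) * P.L : ℕ) : ℝ) ^ 2 * (P.L : ℝ))⁻¹) * B₀ * ε < 1)
    (h3ε : 3 * ε ≤ (60800 * (((P.d + 2) * P.L : ℕ) : ℝ) ^ 2 * (P.L : ℝ))⁻¹ / 4)
    (hθ : θ < deltaSU (Fin N)) (hguard : 32 * (((P.d + 2) * P.L : ℕ) : ℝ) * (P.L : ℝ) * ε ≤ θ)
    (Dfun : (PBond P 0 → Matrix (Fin N) (Fin N) ℂ) → (BondIdx D → Matrix (Fin N) (Fin N) ℂ))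
    (hDball : ∀ A' : PBond P 0 → Matrix (Fin N) (Fin N) ℂ, (∀ b, w 1 b * ‖A' b‖ < ε) →
      ∀ i, ‖Dfun A' i‖ ≤ 4 * (64 * (P.L : ℝ) / (60800 * (((P.d + 2) * P.L : ℕ) : ℝ) ^ 2 * (P.L : ℝ))⁻¹) * ε ^ 2)
    (h49 : ∀ A' : PBond P 0 → Matrix (Fin N) (Fin N) ℂ, (∀ b, w 1 b * ‖A' b‖ < ε) →
      chartLogFlat (((P.L : ℝ)⁻¹) ^ k) D (A' - H (Dfun A')) -
        (fderiv ℂ (chartLogFlat (((P.L : ℝ)⁻¹) ^ k) D : (PBond P 0 → Matrix (Fin N) (Fin N) ℂ) → BondIdx D → Matrix (Fin N) (Fin N) ℂ) 0) (A' - H (Dfun A')) = Dfun A')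
    {A' : PBond P 0 → Matrix (Fin N) (Fin N) ℂ} (hA' : ∀ b, w 1 b * ‖A' b‖ < ε) (hA'h : ∀ b, A' b ∈ herm0 (Fin N)) :
    (∀ i, Dfun A' i ∈ herm0 (Fin N)) ∧ ∀ b, (A' - H (Dfun A')) b ∈ herm0 (Fin N) := by
  have hL0 : (0 : ℝ) < P.L := lt_of_lt_of_le one_pos (by exact_mod_cast P.L_pos)
  have hℓ0 : (0 : ℝ) < (((P.d + 2) * P.L : ℕ) : ℝ) := by exact_mod_cast Nat.pos_of_ne_zero (Nat.mul_ne_zero (by omega) (by have := P.hL.2; omega))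
  have hden : 0 < 60800 * (((P.d + 2) * P.L : ℕ) : ℝ) ^ 2 * (P.L : ℝ) := by positivity
  have hRM : 2 * P.L ≤ R' * M + 1 := by have : R' ≤ R' * M := Nat.le_mul_of_pos_right R' hM; omega
  have hcollar := collar_of_adm22 D hAdm hRM
  -- the window of §2 at radius `2ε`: `60800ℓ²L·(2ε) ≤ 1` from `3ε ≤ R⋆♭∕4`, and the guard `16ℓL(2ε) = 32ℓLε ≤ θ`
  have hR2 : 16 * 3800 * (((P.d + 2) * P.L : ℕ) : ℝ) ^ 2 * (P.L : ℝ) * (2 * ε) ≤ 1 := by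
    have h1 : 2 * ε ≤ (60800 * (((P.d + 2) * P.L : ℕ) : ℝ) ^ 2 * (P.L : ℝ))⁻¹ := by
      have : (0 : ℝ) ≤ (60800 * (((P.d + 2) * P.L : ℕ) : ℝ) ^ 2 * (P.L : ℝ))⁻¹ := by positivity
      linarith
    calc 16 * 3800 * (((P.d + 2) * P.L : ℕ) : ℝ) ^ 2 * (P.L : ℝ) * (2 * ε)
        ≤ 16 * 3800 * (((P.d + 2) * P.L : ℕ) : ℝ) ^ 2 * (P.L : ℝ) * (60800 * (((P.d + 2) * P.L : ℕ) : ℝ) ^ 2 * (P.L : ℝ))⁻¹ :=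
          mul_le_mul_of_nonneg_left h1 (by positivity)
      _ = 1 := by rw [show (16 : ℝ) * 3800 = 60800 by norm_num, mul_inv_cancel₀ hden.ne']
  have hguard2 : 16 * (((P.d + 2) * P.L : ℕ) : ℝ) * (P.L : ℝ) * (2 * ε) ≤ θ := by
    rw [show 16 * (((P.d + 2) * P.L : ℕ) : ℝ) * (P.L : ℝ) * (2 * ε) = 32 * (((P.d + 2) * P.L : ℕ) : ℝ) * (P.L : ℝ) * ε by ring]; exact hguard
  exact chartDFlat_valued_of_chartLogFlat k D hDk hAdm hR'L hM hw H hB₀ hHB hε hq h3ε (herm0 (Fin N))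
    (fun X hX b => realKernel_mem (herm0 (Fin N)) (fun X => H X) hker hH hX b)
    (fun Y hY hYh i => chartLogFlat_mem_herm0_weightedBall_P k D hDk hcollar hw hR2 hθ hguard2 hY hYh i)
    Dfun hDball h49 A' hA' hA'h

end Summit.QuantumFields.YangMills.Theorems.K0Stub1FlatChartSlN

end
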